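import Mathlib
import HarnessLib
import Literature.Analysis.FluidPDE.VectorCalculus
import Literature.Analysis.FluidPDE.VorticityCalculus
import Literature.Analysis.FluidPDE.ClassicalSolution
import Literature.Analysis.FluidPDE.SpaceTimeCalculus
import Literature.Analysis.FluidPDE.ConvectCommutatorCalculus
import Literature.Analysis.FluidPDE.FirstIntegralTransportDefect
import Literature.Analysis.FluidPDE.TypeIAncientMild
import Literature.Analysis.FluidPDE.TypeIAncientMildClassical
import Summits.NavierStokesRegularity.NavierStokesRegularity.Theorems.PoloidalWindowDoorPoloidalWindowRigidityWindow

/-!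
# Route `PoloidalWindowDoor`, crux `PoloidalWindowRigidity` (K2, stmt-NavierStokesRegularity-19708) —
# the VELOCITY-GRADIENT LAW of the profile class and `curl` of the momentum residual

Cell ns-regularity-ideate, seat ns-poloidal-K2-p3 (stub-worker, gen 2; support theorems `--supports` the crux,
`--as helper`).  Kernel input for the K2 lead's H4c programme (K2P1-S2-NOTES v4 §4: on the separated-pressure stratum
the horizontal gradient `∇_h v₃` and the horizontal vorticity `ω_h` obey the SAME linear law — the Clebsch-slope law
(★★) is its ratio form, kit-certified only, j259272).  Write `f := ∂ₜv + (v·∇)v − Δv` for the INTRINSIC momentum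
residual of a profile `v` of the route's Type-I class (`= −∇p` on every window) and `L := ∂ₜ + (v·∇) − Δ`.

* `fderiv_transport_identity` — PURE CALCULUS (any `w : ℝ → ℝ³ → ℝ³` jointly `C²` at `(t,x)` with a `C^∞` slice):
  `L(∂ₐw) = ∂ₐ(∂ₜw + (w·∇)w − Δw) − Dw(∂ₐw)` at `(t,x)` for every direction `a` — mixed partials
  (Literature `hasDerivAt_fderiv_slice_of_contDiffAt`), the Leibniz rule for the convective term
  (`fderiv_convect_apply_eqOn`) and `[∂ₐ, Δ] = 0` (`laplacian_fderiv_apply_of_contDiffAt`).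
* `fderiv_equation` — for the class: **`L(∂ₐv) = −Dv(∂ₐv) + ∂ₐf`** on the open slab (vector form), and its
  Cartesian components `fderiv_equation_coord` (`θ = (∂ₐv)ᵢ`: `∂ₜθ + Dθ(v) − Δθ = (∂ₐf)ᵢ − (Dv(∂ₐv))ᵢ`, the shape
  consumed by the lead's L4-type lemmas).
* `curl_residual_eq_zero` — for the class `curl f(t,·) ≡ 0` (`f = −∇p` for the classical pressure of the window
  `(2t, 0)`, Literature `IsTypeIAncientMild.exists_isClassicalNSSolutionOn_Ioo` + `curl_gradient_eq_zero_holds`), and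
  its two coordinate instances `∂ᵦf₃ = ∂₃fᵦ` (`b = 0, 1`) used by the separated-pressure file.

WHAT THIS IS NOT: not a claim about Navier–Stokes regularity and not the open residue S2′ — kernel bookkeeping
(differentiated momentum equation) for a door route's Type-I Liouville problem (bears_on LADDER-NS N0, rung
N0-LocalTubeDoorPoloidal).
-/

noncomputable section

-- the summit and its single sub-problem share the name (CONVENTIONS §1), as in every Theorems file
set_option linter.dupNamespace false

namespace Summit.NavierStokesRegularity.NavierStokesRegularity.Theorems.PoloidalWindowDoorPoloidalWindowRigidityVelocityGradientLaw

open MeasureTheory Set Function Filter Topology TopologicalSpace Metric InnerProductSpace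
open scoped RealInnerProductSpace InnerProductSpace Laplacian ContDiff
open Literature.Analysis Literature.Analysis.FluidPDE
open Summit.NavierStokesRegularity.NavierStokesRegularity.Theorems.PoloidalWindowDoorPoloidalWindowRigidityWindow

variable {C : ℝ} {v : ℝ → EuclideanSpace ℝ (Fin 3) → EuclideanSpace ℝ (Fin 3)}

/-! ### Pure calculus: the transport law of a directional derivative -/

/-- **`L(∂ₐw) = ∂ₐ(∂ₜw + (w·∇)w − Δw) − Dw(∂ₐw)` (pure calculus).**  For `w : ℝ → ℝ³ → ℝ³` with `uncurry w`
of class `C²` at `(t,x)` and a `C^∞` slice `w t`, and any direction `a`: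
`∂ₜ(∂ₐw) + D(∂ₐw)(w) − Δ(∂ₐw) = ∂ₐ(∂ₜw + (w·∇)w − Δw) − Dw(∂ₐw)` at `(t, x)`. -/
theorem fderiv_transport_identity {w : ℝ → EuclideanSpace ℝ (Fin 3) → EuclideanSpace ℝ (Fin 3)} {t : ℝ}
    {x : EuclideanSpace ℝ (Fin 3)} (hw : ContDiffAt ℝ 2 (uncurry w) (t, x)) (hs : ContDiff ℝ ∞ (w t))
    (a : EuclideanSpace ℝ (Fin 3)) :
    deriv (fun s => fderiv ℝ (w s) x a) t + fderiv ℝ (fun y => fderiv ℝ (w t) y a) x (w t x)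
        - Δ (fun y => fderiv ℝ (w t) y a) x =
      fderiv ℝ (fun y => deriv (fun s => w s y) t + convect (w t) (w t) y - Δ (w t) y) x a
        - fderiv ℝ (w t) x (fderiv ℝ (w t) x a) := by
  obtain ⟨hdot, hc⟩ := hasDerivAt_fderiv_slice_of_contDiffAt hw
  have h3 : ContDiffAt ℝ 3 (w t) x := hs.contDiffAt.of_le (by norm_cast)
  have hD2 : ContDiffAt ℝ 2 (fderiv ℝ (w t)) x := (hs.fderiv_right (m := 2) (by norm_cast)).contDiffAt
  -- (T) time derivative of `∂ₐw`
  have hT : deriv (fun s => fderiv ℝ (w s) x a) t = fderiv ℝ (fun y => deriv (fun s => w s y) t) x a := by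
    have h := ((ContinuousLinearMap.apply ℝ (EuclideanSpace ℝ (Fin 3)) a).hasFDerivAt.comp_hasDerivAt t hc).deriv
    simpa [Function.comp_def] using h
  -- (X) Leibniz rule for `∂ₐ((w·∇)w)`
  have hX : fderiv ℝ (convect (w t) (w t)) x a =
      fderiv ℝ (w t) x (fderiv ℝ (w t) x a) + fderiv ℝ (fun y => fderiv ℝ (w t) y a) x (w t x) := by
    have h := fderiv_convect_apply_eqOn isOpen_univ hs.contDiffOn hs.contDiffOn a (mem_univ x)
    simpa [convect] using h
  -- (L) `[∂ₐ, Δ] = 0`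
  have hL : fderiv ℝ (Δ (w t)) x a = Δ (fun y => fderiv ℝ (w t) y a) x := by
    rw [← laplacian_fderiv_apply_of_contDiffAt (EuclideanSpace.basisFun (Fin 3) ℝ) h3 a]
    have hfun : (fun y => fderiv ℝ (w t) y a) =
        (ContinuousLinearMap.apply ℝ (EuclideanSpace ℝ (Fin 3)) a) ∘ fderiv ℝ (w t) := by
      funext y; simp
    rw [hfun, hD2.laplacian_CLM_comp_left]
    simp
  -- differentiability of the three terms of the residual
  have hdA : DifferentiableAt ℝ (fun y => deriv (fun s => w s y) t) x := hdot
  have hdB : DifferentiableAt ℝ (convect (w t) (w t)) x := by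
    have h := (hs.fderiv_right (m := 1) (by norm_cast)).clm_apply (hs.of_le (by norm_cast))
    exact (h.differentiable (by simp)) x
  have hdC : DifferentiableAt ℝ (Δ (w t)) x := differentiableAt_laplacian_of_contDiffAt h3
  have hsum : fderiv ℝ (fun y => deriv (fun s => w s y) t + convect (w t) (w t) y - Δ (w t) y) x a =
      fderiv ℝ (fun y => deriv (fun s => w s y) t) x a + fderiv ℝ (convect (w t) (w t)) x a
        - fderiv ℝ (Δ (w t)) x a := by
    rw [fderiv_fun_sub (hdA.fun_add hdB) hdC, fderiv_fun_add hdA hdB]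
    rfl
  rw [hsum, hT, hX, hL]
  abel

/-! ### The velocity-gradient law of the class -/

/-- Joint smoothness of the class at interior points of the slab. -/
theorem contDiffAt_uncurry_of_class (hrate : HasTypeITimeDecay C v)
    (hcont : ContinuousOn (uncurry v) (Iio (0 : ℝ) ×ˢ univ))
    (hmild : ∀ s t : ℝ, s < t → t < 0 → ∀ x,
      v t x = UnboundedOperators.heatExtension (v s) (t - s) x - oseenDuhamel 1 s v v t x)
    (hdiv : ∀ t < 0, VectorCalculus.IsDivFree (v t)) {t : ℝ} (ht : t < 0) (x : EuclideanSpace ℝ (Fin 3))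
    (n : ℕ) : ContDiffAt ℝ n (uncurry v) (t, x) := by
  have hA : IsTypeIAncientMild C v := isTypeIAncientMild_of_class hrate hcont hmild hdiv
  have hmem : Iio (0 : ℝ) ×ˢ (univ : Set (EuclideanSpace ℝ (Fin 3))) ∈ 𝓝 (t, x) :=
    (isOpen_Iio.prod isOpen_univ).mem_nhds ⟨ht, mem_univ x⟩
  exact (hA.contDiffOn.of_le (by norm_cast; exact le_top)).contDiffAt hmem

/-- On the open slab the one-sided time derivative is the two-sided one. -/
theorem timeDerivWithin_Iio_eq_deriv {t : ℝ} (ht : t < 0) :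
    timeDerivWithin (Iio 0) v t = fun y => deriv (fun s => v s y) t :=
  timeDerivWithin_eq_deriv_of_isOpen_subset isOpen_Iio subset_rfl ht v

/-- **VELOCITY-GRADIENT LAW (vector form).**  For a profile of the route's Type-I class, every `t < 0`, `x` and
direction `a`: `∂ₜ(∂ₐv) + D(∂ₐv)(v) − Δ(∂ₐv) = ∂ₐf − Dv(∂ₐv)` with `f = ∂ₜv + (v·∇)v − Δv` the intrinsic residual
(`= −∇p`): the differentiated momentum equation `L(∇v) = −(∇v)² − ∇²p`. -/
theorem fderiv_equation (hrate : HasTypeITimeDecay C v)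
    (hcont : ContinuousOn (uncurry v) (Iio (0 : ℝ) ×ˢ univ))
    (hmild : ∀ s t : ℝ, s < t → t < 0 → ∀ x,
      v t x = UnboundedOperators.heatExtension (v s) (t - s) x - oseenDuhamel 1 s v v t x)
    (hdiv : ∀ t < 0, VectorCalculus.IsDivFree (v t)) {t : ℝ} (ht : t < 0) (x a : EuclideanSpace ℝ (Fin 3)) :
    deriv (fun s => fderiv ℝ (v s) x a) t + fderiv ℝ (fun y => fderiv ℝ (v t) y a) x (v t x)
        - Δ (fun y => fderiv ℝ (v t) y a) x =
      fderiv ℝ (fun y => timeDerivWithin (Iio 0) v t y + convect (v t) (v t) y - Δ (v t) y) x a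
        - fderiv ℝ (v t) x (fderiv ℝ (v t) x a) := by
  have hA : IsTypeIAncientMild C v := isTypeIAncientMild_of_class hrate hcont hmild hdiv
  rw [timeDerivWithin_Iio_eq_deriv ht]
  exact fderiv_transport_identity (contDiffAt_uncurry_of_class hrate hcont hmild hdiv ht x 2)
    (hA.contDiff_slice ht) a

/-- **VELOCITY-GRADIENT LAW (coordinates).**  For a profile of the class, `t < 0`, `x`, a direction `a` and a
coordinate `i`, the scalar `θ(s,y) = (∂ₐv)ᵢ(s,y) = (Dv(s,y) a)ᵢ` satisfies
`∂ₜθ + Dθ(v) − Δθ = (∂ₐf)ᵢ − (Dv(∂ₐv))ᵢ` at `(t,x)` — the shape of the lead's transported-scalar lemmas. -/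
theorem fderiv_equation_coord (hrate : HasTypeITimeDecay C v)
    (hcont : ContinuousOn (uncurry v) (Iio (0 : ℝ) ×ˢ univ))
    (hmild : ∀ s t : ℝ, s < t → t < 0 → ∀ x,
      v t x = UnboundedOperators.heatExtension (v s) (t - s) x - oseenDuhamel 1 s v v t x)
    (hdiv : ∀ t < 0, VectorCalculus.IsDivFree (v t)) {t : ℝ} (ht : t < 0) (x a : EuclideanSpace ℝ (Fin 3))
    (i : Fin 3) :
    deriv (fun s => fderiv ℝ (v s) x a i) t + fderiv ℝ (fun y => fderiv ℝ (v t) y a i) x (v t x)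
        - Δ (fun y => fderiv ℝ (v t) y a i) x =
      fderiv ℝ (fun y => timeDerivWithin (Iio 0) v t y + convect (v t) (v t) y - Δ (v t) y) x a i
        - fderiv ℝ (v t) x (fderiv ℝ (v t) x a) i := by
  have hA : IsTypeIAncientMild C v := isTypeIAncientMild_of_class hrate hcont hmild hdiv
  have hs : ContDiff ℝ ∞ (v t) := hA.contDiff_slice ht
  have hvec := fderiv_equation hrate hcont hmild hdiv ht x a
  obtain ⟨_, hc⟩ := hasDerivAt_fderiv_slice_of_contDiffAt (contDiffAt_uncurry_of_class hrate hcont hmild hdiv ht x 2)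
  set P : EuclideanSpace ℝ (Fin 3) →L[ℝ] ℝ := EuclideanSpace.proj (𝕜 := ℝ) i with hP
  -- the slice map `y ↦ ∂ₐv(t,y)` is `C^∞`
  have hWs : ContDiff ℝ ∞ (fun y => fderiv ℝ (v t) y a) :=
    (hs.fderiv_right (m := ∞) (by norm_cast)).clm_apply contDiff_const
  -- (T) components commute with the time derivative
  have hT : deriv (fun s => fderiv ℝ (v s) x a i) t = (deriv (fun s => fderiv ℝ (v s) x a) t) i := by
    have hca : HasDerivAt (fun s => fderiv ℝ (v s) x a) (deriv (fun s => fderiv ℝ (v s) x a) t) t := by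
      have h := (ContinuousLinearMap.apply ℝ (EuclideanSpace ℝ (Fin 3)) a).hasFDerivAt.comp_hasDerivAt t hc
      have h' : HasDerivAt (fun s => fderiv ℝ (v s) x a)
          ((fderiv ℝ (fun y => deriv (fun s => v s y) t) x) a) t := by
        simpa [Function.comp_def] using h
      exact h'.differentiableAt.hasDerivAt
    have h := (P.hasFDerivAt.comp_hasDerivAt t hca).deriv
    simpa [hP, Function.comp_def] using h
  -- (X) components commute with the spatial derivative
  have hX : fderiv ℝ (fun y => fderiv ℝ (v t) y a i) x (v t x) =
      (fderiv ℝ (fun y => fderiv ℝ (v t) y a) x (v t x)) i := by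
    have hd : DifferentiableAt ℝ (fun y => fderiv ℝ (v t) y a) x := (hWs.differentiable (by simp)) x
    have hfun : (fun y => fderiv ℝ (v t) y a i) = P ∘ fun y => fderiv ℝ (v t) y a := by
      funext y; simp [hP]
    rw [hfun, (P.hasFDerivAt.comp x hd.hasFDerivAt).fderiv]
    simp [hP]
  -- (L) components commute with the Laplacian
  have hL : Δ (fun y => fderiv ℝ (v t) y a i) x = (Δ (fun y => fderiv ℝ (v t) y a) x) i := by
    have hfun : (fun y => fderiv ℝ (v t) y a i) = P ∘ fun y => fderiv ℝ (v t) y a := by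
      funext y; simp [hP]
    rw [hfun, (hWs.contDiffAt.of_le (by norm_cast)).laplacian_CLM_comp_left]
    simp [hP]
  rw [hT, hX, hL]
  have h := congrArg (fun z : EuclideanSpace ℝ (Fin 3) => z i) hvec
  simpa using h

/-! ### `curl f ≡ 0` for the class -/

/-- **The momentum residual of the class is a gradient: `curl f(t,·) ≡ 0`.**  On the window `(2t, 0)` the profile
is a classical Navier–Stokes solution with a smooth pressure `p` (Literature
`IsTypeIAncientMild.exists_isClassicalNSSolutionOn_Ioo`), so `f(t,·) = −∇p(t,·)` and `curl ∇p = 0`. -/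
theorem curl_residual_eq_zero (hrate : HasTypeITimeDecay C v)
    (hcont : ContinuousOn (uncurry v) (Iio (0 : ℝ) ×ˢ univ))
    (hmild : ∀ s t : ℝ, s < t → t < 0 → ∀ x,
      v t x = UnboundedOperators.heatExtension (v s) (t - s) x - oseenDuhamel 1 s v v t x)
    (hdiv : ∀ t < 0, VectorCalculus.IsDivFree (v t)) {t : ℝ} (ht : t < 0) (x : EuclideanSpace ℝ (Fin 3)) :
    curl (fun y => timeDerivWithin (Iio 0) v t y + convect (v t) (v t) y - Δ (v t) y) x = 0 := by
  have hA : IsTypeIAncientMild C v := isTypeIAncientMild_of_class hrate hcont hmild hdiv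
  have h2t : 2 * t < 0 := by linarith
  have htS : t ∈ Ioo (2 * t) 0 := ⟨by linarith, ht⟩
  obtain ⟨p, hns⟩ := hA.exists_isClassicalNSSolutionOn_Ioo h2t
  -- the residual on the window is `−∇p`
  have hres : (fun y => timeDerivWithin (Iio 0) v t y + convect (v t) (v t) y - Δ (v t) y) =
      fun y => -gradient (p t) y := by
    funext y
    have hm := hns.momentum t htS y
    have hTD : timeDerivWithin (Ioo (2 * t) 0) v t y = timeDerivWithin (Iio 0) v t y := by
      rw [timeDerivWithin_eq_deriv_of_isOpen_subset isOpen_Ioo subset_rfl htS v,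
        timeDerivWithin_eq_deriv_of_isOpen_subset isOpen_Iio subset_rfl ht v]
    simp only [hTD, one_smul, Pi.zero_apply, add_zero] at hm
    rw [hm]
    abel
  have hp2 : ContDiff ℝ 2 (p t) := (hns.contDiff_pressure htS).of_le (by norm_cast)
  rw [hres, curl_neg, curl_gradient_eq_zero_holds (p t) hp2 x, neg_zero]

/-- **Coordinate instances of `curl f = 0`**: `(∂₁f)₂ = (∂₂f)₁` and `(∂₀f)₂ = (∂₂f)₀` (indices `0,1` horizontal,
`2` vertical), i.e. `∂ᵦ f₃ = ∂₃ f_b` — the mixed second derivatives of the pressure commute. -/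
theorem fderiv_residual_symm (hrate : HasTypeITimeDecay C v)
    (hcont : ContinuousOn (uncurry v) (Iio (0 : ℝ) ×ˢ univ))
    (hmild : ∀ s t : ℝ, s < t → t < 0 → ∀ x,
      v t x = UnboundedOperators.heatExtension (v s) (t - s) x - oseenDuhamel 1 s v v t x)
    (hdiv : ∀ t < 0, VectorCalculus.IsDivFree (v t)) {t : ℝ} (ht : t < 0) (x : EuclideanSpace ℝ (Fin 3)) :
    fderiv ℝ (fun y => timeDerivWithin (Iio 0) v t y + convect (v t) (v t) y - Δ (v t) y) x
          (EuclideanSpace.single 0 1) 2 =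
        fderiv ℝ (fun y => timeDerivWithin (Iio 0) v t y + convect (v t) (v t) y - Δ (v t) y) x
          (EuclideanSpace.single 2 1) 0 ∧
      fderiv ℝ (fun y => timeDerivWithin (Iio 0) v t y + convect (v t) (v t) y - Δ (v t) y) x
          (EuclideanSpace.single 1 1) 2 =
        fderiv ℝ (fun y => timeDerivWithin (Iio 0) v t y + convect (v t) (v t) y - Δ (v t) y) x
          (EuclideanSpace.single 2 1) 1 := by
  have h := curl_residual_eq_zero hrate hcont hmild hdiv ht x
  have h0 := congrArg (fun z : EuclideanSpace ℝ (Fin 3) => z 0) h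
  have h1 := congrArg (fun z : EuclideanSpace ℝ (Fin 3) => z 1) h
  simp only [curl, PiLp.toLp_apply, Matrix.cons_val_zero, Matrix.cons_val_one, PiLp.zero_apply] at h0 h1
  constructor
  · linarith
  · linarith

end Summit.NavierStokesRegularity.NavierStokesRegularity.Theorems.PoloidalWindowDoorPoloidalWindowRigidityVelocityGradientLaw

end
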